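import Mathlib
import HarnessLib
import Summits.ResolutionOfSingularities.ResolutionOfSingularities.Theorems.WildQuotientsWildQuotientResolutionS1aKillFreeNamedKill
import Summits.ResolutionOfSingularities.ResolutionOfSingularities.Theorems.WildQuotientsWildQuotientResolutionS1aKillFreeRestrict
import Summits.ResolutionOfSingularities.ResolutionOfSingularities.Theorems.WildQuotientsWildQuotientResolutionS1aPrincipalCentreGood

/-!
# S1a — K-FREE FRAME, the (KN) node: a NAMED KILL meeting a top formal component IS a `μ_F`-lowering tree step (`treeF_one_of_namedKill`)

[OURS · L1 W4.5c · lead-1 g11; plan-1 ASSIGNMENT v10.34 «(F-T2) → (F-T3) → treeF_one_of_namedKill», A-KF v0 (O3)/(O5)/(KN)] — NOT statements of the manuscript;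
counted 0; AI-level work, weaker than expert review. Crux stmt-ResolutionOfSingularities-17941 `CyclicQuotientFourfolds`, line `s1a-logminvertex` v12 (`stub_reachLowerInF`).

The RE-DECORATION of a realisation `π′ : M′ → M` of a named principal centre `(𝒦, d)` at `(M, 𝔄)`, relative to a DESIGNATED family `(O_c)_c` of
principal-centre charts covering the support (the producer's own kill charts; `U := ⋃ O_c`):
  `𝔄′ :=` {TRANSFERS of the RESTRICTIONS `Dᵢ|_{D(b)}`, `b` invariant with `D(b) ⊆ Oᵢ ∖ supp`}
        ∪ {the KILLED producer charts at the points `v′` over the `O_c`, SHRUNK inside `π′⁻¹ O_c`}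
((F-T2) `…S1aKillFreeTransport/Restrict`; (F-T3) `exists_killedNode_of_isPrincipalCentreChart`). Bookkeeping, EXACT form: `F_𝔄′ = π′⁻¹(F_𝔄 ∖ U)`
(`exists_killAtlas`: (B-over) own principality of the killed charts; (B-off) B1 both halves for the transported charts + the invariant basic opens of
`GoodCharts.exists_invariant_basicOpen`; the killed charts lie over `U`). The measure half (p655181, here relative to any open `U ⊇ supp` and with (B-off) in one
direction, `lexLTF_of_principalMove_of_bookkeeping'`) then gives `LexLTF M′ 𝔄′ M 𝔄`.

* `lexLTF_of_principalMove_of_bookkeeping'` — measure half relative to an open `U ⊇ supp`, one-directional (B-off);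
* `exists_killedNodeData`, `exists_killedNodeData_le` — (F-T3) killed node DATA at a point over a principal-centre chart (shrunk inside its preimage);
* ★★ `exists_killAtlas` — the re-decoration EXISTS with EXACT bookkeeping `F_𝔄′ = π′⁻¹(F_𝔄 ∖ U)` (the producer PREDICTS the new formal locus; the atlas is
  built inside the proof — this file is definition-free);
* ★★★ `treeF_one_of_namedKill` — at a decorated model with Noetherian base, compact, `dim F_𝔄 < n`: a NAMED principal centre with designated kill charts whose support
  meets a TOP component of `F_𝔄` is a depth-1 `TreeF` node reaching `μ_F`-lower decorated models, for every class `P` accepting the decorations with formal locus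
  `π′⁻¹(F_𝔄 ∖ U)`: THE (KN) NODE IS KERNEL (no compatibility, no ADD-NP, no K); `treeF_one_of_namedKill'` — the same with `U = principalKillOpen` (all charts).
-/

set_option linter.dupNamespace false

noncomputable section

open CategoryTheory Limits AlgebraicGeometry TopologicalSpace Topology
open Literature.AlgebraicGeometry.Resolution Literature.AlgebraicGeometry.RelativeSpec
open Summit.ResolutionOfSingularities.ResolutionOfSingularities.Theorems.WildQuotientResolution.S1
open Summit.ResolutionOfSingularities.ResolutionOfSingularities.Theorems.WildQuotientResolution.S1.NodeAtlas
open Summit.ResolutionOfSingularities.ResolutionOfSingularities.Theorems.WildQuotientResolution.S1.CompCount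
open Summit.ResolutionOfSingularities.ResolutionOfSingularities.Theorems.WildQuotientResolution.S1.NpFrame
open Summit.ResolutionOfSingularities.ResolutionOfSingularities.Theorems.WildQuotientResolution.S1.GoodCharts
open Summit.ResolutionOfSingularities.ResolutionOfSingularities.Theorems.WildQuotientResolution.S1.NodeChartAway
open Summit.ResolutionOfSingularities.ResolutionOfSingularities.Theorems.WildQuotientResolution.S1.KillableTransport
open Summit.ResolutionOfSingularities.ResolutionOfSingularities.Theorems.WildQuotientResolution.S1.BlowupCharts

namespace Summit.ResolutionOfSingularities.ResolutionOfSingularities.Theorems.WildQuotientResolution.S1.GameFrame.GModel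

variable {p : ℕ} {X' X₁ : Scheme.{0}} {q : X' ⟶ X₁} {G : Type} [Group G] {ρ : G →* Aut X'} {g₀ : G}

/-! ## The measure half, one-directional bookkeeping -/

/-- **A NAMED KILL LOWERS `μ_F` — measure half, relative to any OPEN `U ⊇ supp` (e.g. the union of the producer's DESIGNATED kill charts), with (B-off) in ONE
direction** (`v′ ∈ F_𝔄′ ⇒ π′v′ ∉ U ∧ π′v′ ∈ F_𝔄`). [OURS · L1 W4.5c] -/
theorem lexLTF_of_principalMove_of_bookkeeping' (M M' : GModel p q G ρ g₀) [CompactSpace M.V] (𝔄 : NodeAtlasData p M.act g₀) {n : ℕ}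
    (hdim : M.fdim 𝔄 < n) (𝒦 : ReesFiltration M.V) (d : ℕ) {U : Set M.V} (hU : IsOpen U) (hsuppK : ((𝒦.ideal d).support : Set M.V) ⊆ U)
    {t : Set ↥𝔄.fLocus} (ht : t ∈ irreducibleComponents ↥𝔄.fLocus) (hdt : topologicalKrullDim ↥t = M.fdim 𝔄)
    (htouch : ∃ x ∈ t, (x : M.V) ∈ ((𝒦.ideal d).support : Set M.V))
    (π' : M'.V ⟶ M.V) (hbl : IsBlowup π' (𝒦.ideal d)) (𝔄' : NodeAtlasData p M'.act g₀)
    (hoff : ∀ v' : M'.V, v' ∈ 𝔄'.fLocus → π'.base v' ∉ U ∧ π'.base v' ∈ 𝔄.fLocus) :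
    LexLTF M' 𝔄' M 𝔄 := by
  let W : M.V.Opens := (𝒦.ideal d).support.compl
  have hoffK : ∀ v' : ↥𝔄'.fLocus, π'.base v'.1 ∉ U := fun v' => (hoff v'.1 v'.2).1
  have hW : ∀ v' : ↥𝔄'.fLocus, v'.1 ∈ π' ⁻¹ᵁ W := fun v' h => hoffK v' (hsuppK h)
  have key : ∀ v' : ↥𝔄'.fLocus, π'.base v'.1 ∈ 𝔄.fLocus := fun v' => (hoff v'.1 v'.2).2
  haveI hiso : IsIso (π' ∣_ W) := hbl.isIso_morphismRestrict (U := W) (by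
    rw [Set.disjoint_iff]; rintro x ⟨hx, hx'⟩; exact hx hx')
  let e : ↥(π' ⁻¹ᵁ W) ≃ₜ ↥W := Scheme.homeoOfIso (asIso (π' ∣_ W))
  let φ₀ : ↥𝔄'.fLocus → M.V := fun v' => ((e ⟨v'.1, hW v'⟩ : ↥W) : M.V)
  have hφ₀ : ∀ v', φ₀ v' = π'.base v'.1 := fun v' => by
    have h1 : (e ⟨v'.1, hW v'⟩ : ↥W) = (π' ∣_ W).base ⟨v'.1, hW v'⟩ := rfl
    change ((e ⟨v'.1, hW v'⟩ : ↥W) : M.V) = _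
    rw [h1]
    exact morphismRestrict_base_coe π' W ⟨v'.1, hW v'⟩
  have hind₀ : IsInducing φ₀ := by
    refine IsInducing.subtypeVal.comp (e.isInducing.comp ?_)
    exact (IsInducing.subtypeVal.codRestrict hW : IsInducing fun v' : ↥𝔄'.fLocus => (⟨v'.1, hW v'⟩ : ↥(π' ⁻¹ᵁ W)))
  have hinj₀ : Function.Injective φ₀ := by
    intro a b hab
    have h1 : (e ⟨a.1, hW a⟩ : ↥W) = e ⟨b.1, hW b⟩ := Subtype.ext hab
    have h2 := e.injective h1
    exact Subtype.ext (congrArg (fun x : ↥(π' ⁻¹ᵁ W) => (x : M'.V)) h2)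
  have hmem₀ : ∀ v', φ₀ v' ∈ 𝔄.fLocus := fun v' => by rw [hφ₀]; exact key v'
  let ψ : ↥𝔄'.fLocus → ↥𝔄.fLocus := Set.codRestrict φ₀ 𝔄.fLocus hmem₀
  have hψ : IsEmbedding ψ := ⟨hind₀.codRestrict hmem₀, (Set.injective_codRestrict hmem₀).mpr hinj₀⟩
  -- the range lies in the closed set `F_𝔄 ∖ killOpen`
  let C : Set ↥𝔄.fLocus := {z | (z : M.V) ∉ U}
  have hrange : Set.range ψ ⊆ C := by
    rintro _ ⟨v', rfl⟩
    change φ₀ v' ∉ _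
    rw [hφ₀]
    exact hoffK v'
  have hCclosed : IsClosed C := hU.isClosed_compl.preimage continuous_subtype_val
  have hle : M'.fdim 𝔄' ≤ M.fdim 𝔄 := hψ.isInducing.topologicalKrullDim_le
  rcases hle.lt_or_eq with hlt | heq
  · exact Or.inl hlt
  have hbot : M.fdim 𝔄 ≠ ⊥ := by
    intro hbot
    rw [fdim, topologicalKrullDim, Order.krullDim_eq_bot_iff] at hbot
    obtain ⟨x, -⟩ := ht.1.nonempty
    exact hbot.elim ⟨closure {x}, isIrreducible_singleton.closure, isClosed_closure⟩
  obtain ⟨k, hk⟩ := exists_nat_eq_of_ne_bot_of_lt hbot hdim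
  have htr : ¬ t ⊆ closure (Set.range ψ) := by
    intro hsub
    have hsub' : t ⊆ C := hsub.trans (closure_minimal hrange hCclosed)
    obtain ⟨x, hxt, hxs⟩ := htouch
    exact hsub' hxt (hsuppK hxs)
  exact Or.inr ⟨heq, Or.inl (TopCount.nTopComp_lt_of_isEmbedding_of_not_subset_closure hψ hk (heq.trans hk)
    (M.finite_irreducibleComponents_fLocus 𝔄) ht (hdt.trans hk) htr)⟩

/-! ## (F-T3) the killed producer charts -/

section Killed

variable [Finite G] (hp : p.Prime) (hG : ∀ g : G, g ∈ Subgroup.zpowers g₀) (M M' : GModel p q G ρ g₀) (𝒦 : ReesFiltration M.V) (d : ℕ)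
  (hprin : IsPrincipalCentre p M.act g₀ 𝒦 d) (π' : M'.V ⟶ M.V) (hbl : IsBlowup π' (𝒦.ideal d)) (hr : M'.r = π' ≫ M.r)
  (hcomm : ∀ g : G, (M'.act.aut g).hom ≫ π' = π' ≫ (M.act.aut g).hom)
  {R₀ : Type} [CommRing R₀] (s : M.V ⟶ Spec (.of R₀)) [LocallyOfFiniteType s] (hs : ∀ g : G, (M.act.aut g).hom ≫ s = s)

omit [Finite G] in
include hp hG hprin hbl hr hcomm hs in
/-- The existence statement of a killed node chart at a point over a principal-centre chart. -/
theorem exists_killedNodeData (O : M.act.StableAffineOpens) (hO : IsPrincipalCentreChart p M.act g₀ 𝒦 d O) (v' : M'.V) (hv' : π'.base v' ∈ O.1) :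
    ∃ (O' : M'.act.StableAffineOpens) (D' : NodeData p M'.act g₀ O'), v' ∈ O'.1 ∧ D'.PrincipalNear v' := by
  obtain ⟨O', hv'O', hO', m, r, B', _, 𝒜', _, σ', e', hnode, he', hI, -⟩ :=
    exists_killedNode_of_isPrincipalCentreChart M.act hbl (fun g => hprin.2.1 g d) M'.act hcomm g₀ hr hp hG 𝒦 d rfl O hO s hs v' hv'
  let D' : NodeData p M'.act g₀ O' :=
    { affine := hO', m := m, r := r, B := B', 𝒜 := 𝒜', σ := σ', e := e', tame := hnode, intertwine := he' }
  refine ⟨O', D', hv'O', 1, fun g => map_one _, ?_, ?_⟩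
  · rw [Scheme.basicOpen_of_isUnit _ isUnit_one]; exact hv'O'
  · -- `KilledAway D' (e' 1)`: `e' 1 = 1`, and the augmentation ideal is already principal
    change ((augmentationIdeal σ').map (algebraMap B' (Localization.Away ((e' 1 : ↥(𝒜' 0)) : B')))).IsPrincipal
    obtain ⟨⟨g, hg⟩⟩ := hI
    refine ⟨⟨algebraMap B' _ g, ?_⟩⟩
    rw [Ideal.submodule_span_eq, hg, Ideal.submodule_span_eq, Ideal.map_span, Set.image_singleton]

end Killed

/-! ## The re-decoration `killAtlas` of a realisation, relative to a DESIGNATED family of kill charts -/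

section Atlas

variable [Finite G] (hp : p.Prime) (hG : ∀ g : G, g ∈ Subgroup.zpowers g₀) (M M' : GModel p q G ρ g₀) (𝔄 : NodeAtlasData p M.act g₀)
  (𝒦 : ReesFiltration M.V) (d : ℕ) (hprin : IsPrincipalCentre p M.act g₀ 𝒦 d)
  {κ : Type} (Oc : κ → M.act.StableAffineOpens) (hOc : ∀ c, IsPrincipalCentreChart p M.act g₀ 𝒦 d (Oc c))
  (hcov : ((𝒦.ideal d).support : Set M.V) ⊆ ⋃ c, ((Oc c).1 : Set M.V))
  (π' : M'.V ⟶ M.V) (hbl : IsBlowup π' (𝒦.ideal d)) (hr : M'.r = π' ≫ M.r)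
  (hcomm : ∀ g : G, (M'.act.aut g).hom ≫ π' = π' ≫ (M.act.aut g).hom)
  {R₀ : Type} [CommRing R₀] (s : M.V ⟶ Spec (.of R₀)) [LocallyOfFiniteType s] (hs : ∀ g : G, (M.act.aut g).hom ≫ s = s)

include hp hG hprin hbl hr hcomm hs in
/-- (F-T3 with controlled domain) **A killed node chart at a point over a principal-centre chart, SHRUNK INSIDE the preimage of that chart**
(`exists_killedNodeData` + an invariant basic open + `NodeData.restrict`, `principalNear_restrict_iff`). -/
theorem exists_killedNodeData_le (O : M.act.StableAffineOpens) (hO : IsPrincipalCentreChart p M.act g₀ 𝒦 d O) (v' : M'.V) (hv' : π'.base v' ∈ O.1) :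
    ∃ (O' : M'.act.StableAffineOpens) (D' : NodeData p M'.act g₀ O'), v' ∈ O'.1 ∧ O'.1 ≤ π' ⁻¹ᵁ O.1 ∧ D'.PrincipalNear v' := by
  obtain ⟨O', D', hv'O', hD'⟩ := exists_killedNodeData hp hG M M' 𝒦 d hprin π' hbl hr hcomm s hs O hO v' hv'
  haveI := M'.isIntegral
  obtain ⟨b', hb', hv'b', hle⟩ := GoodCharts.exists_invariant_basicOpen M'.act O' D'.affine hv'O' (π' ⁻¹ᵁ O.1)
    (fun g => preimage_stable_of_comm M M' π' hcomm O.1 (O.2.1) g) hv'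
  exact ⟨basicOpenStable M'.act O' D'.affine hb', D'.restrict hb', hv'b', hle, (D'.principalNear_restrict_iff hb' hv'b').mpr hD'⟩

include hp hG hprin hOc hcov hbl hr hcomm hs in
/-- ★★ **THE RE-DECORATION EXISTS, with EXACT bookkeeping `F_𝔄′ = π′⁻¹(F_𝔄 ∖ ⋃ O_c)`.** The atlas `𝔄′` on the realisation `M′`: the TRANSFERS of the
RESTRICTIONS `(𝔄.D i)|_{D(b)}` over the invariant basic opens `D(b) ⊆ O_i ∖ supp` (B1: `principalNear_transfer_iff`, `principalNear_restrict_iff`), and the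
killed producer charts at the points over the designated kill charts, shrunk inside their preimages (`exists_killedNodeData_le`). (B-over): the killed charts
are principal near their points; (B-off): B1 for the transported charts, and the killed charts lie over `⋃ O_c`. The producer PREDICTS the new formal locus from
its own designated charts — no compatibility, no ADD-NP, no K. [OURS · L1 W4.5c · A-KF v0 (O3)/(O5), Q-KF3] -/
theorem exists_killAtlas :
    ∃ 𝔄' : NodeAtlasData p M'.act g₀, ∀ v' : M'.V, v' ∈ 𝔄'.fLocus ↔ π'.base v' ∉ (⋃ c, ((Oc c).1 : Set M.V)) ∧ π'.base v' ∈ 𝔄.fLocus := by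
  classical
  haveI := M.isIntegral
  -- the off-support charts: transfers of restrictions
  let J : Type := Σ i : 𝔄.ι, {b : Γ(M.V, (𝔄.O i).1) // (∀ g : G, actO M.act (𝔄.O i) g b = b) ∧
      Disjoint ((M.V.basicOpen b : Set M.V)) ((𝒦.ideal d).support : Set M.V)}
  have hiso : ∀ j : J, IsIso (π' ∣_ (basicOpenStable M.act (𝔄.O j.1) (𝔄.D j.1).affine j.2.2.1).1) := fun j =>
    hbl.isIso_morphismRestrict j.2.2.2
  let OJ : J → M'.act.StableAffineOpens := fun j =>
    haveI := hiso j; NodeData.preimageStable M.act M'.act π' hr hcomm (basicOpenStable M.act (𝔄.O j.1) (𝔄.D j.1).affine j.2.2.1)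
  let DJ : ∀ j : J, NodeData p M'.act g₀ (OJ j) := fun j =>
    haveI := hiso j; ((𝔄.D j.1).restrict j.2.2.1).transfer M.act M'.act π' hr hcomm
  have hJ : ∀ (j : J) (v' : M'.V), (DJ j).PrincipalNear v' ↔ π'.base v' ∈ M.V.basicOpen j.2.1 ∧ (𝔄.D j.1).PrincipalNear (π'.base v') := by
    intro j v'
    haveI := hiso j
    have h1 := NodeData.principalNear_transfer_iff M.act M'.act π' hr hcomm ((𝔄.D j.1).restrict j.2.2.1) v'
    constructor
    · intro h
      have h2 := h1.mp h
      have hub : π'.base v' ∈ M.V.basicOpen j.2.1 := ((𝔄.D j.1).restrict j.2.2.1).mem_of_principalNear h2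
      exact ⟨hub, ((𝔄.D j.1).principalNear_restrict_iff j.2.2.1 hub).mp h2⟩
    · rintro ⟨hub, h⟩
      exact h1.mpr (((𝔄.D j.1).principalNear_restrict_iff j.2.2.1 hub).mpr h)
  -- the killed charts over the designated kill charts
  let W : Type := Σ c : κ, {v' : M'.V // π'.base v' ∈ (Oc c).1}
  have hex : ∀ w : W, ∃ (O' : M'.act.StableAffineOpens) (D' : NodeData p M'.act g₀ O'),
      w.2.1 ∈ O'.1 ∧ O'.1 ≤ π' ⁻¹ᵁ (Oc w.1).1 ∧ D'.PrincipalNear w.2.1 := fun w =>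
    exists_killedNodeData_le hp hG M M' 𝒦 d hprin π' hbl hr hcomm s hs (Oc w.1) (hOc w.1) w.2.1 w.2.2
  let OW : W → M'.act.StableAffineOpens := fun w => (hex w).choose
  let DW : ∀ w : W, NodeData p M'.act g₀ (OW w) := fun w => (hex w).choose_spec.choose
  have hW : ∀ w : W, w.2.1 ∈ (OW w).1 ∧ (OW w).1 ≤ π' ⁻¹ᵁ (Oc w.1).1 ∧ (DW w).PrincipalNear w.2.1 := fun w =>
    (hex w).choose_spec.choose_spec
  -- invariant basic opens off the support (`GoodCharts.exists_invariant_basicOpen`)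
  have hoffb : ∀ u : M.V, u ∉ (⋃ c, ((Oc c).1 : Set M.V)) → ∀ i, u ∈ (𝔄.O i).1 →
      ∃ b : Γ(M.V, (𝔄.O i).1), (∀ g : G, actO M.act (𝔄.O i) g b = b) ∧ u ∈ M.V.basicOpen b ∧
        Disjoint ((M.V.basicOpen b : Set M.V)) ((𝒦.ideal d).support : Set M.V) := by
    intro u hu i hi
    have hsupp : u ∈ (((𝒦.ideal d).support.compl : M.V.Opens) : Set M.V) := fun h => hu (hcov h)
    obtain ⟨b, hb, hub, hle⟩ := GoodCharts.exists_invariant_basicOpen M.act (𝔄.O i) (𝔄.D i).affine hi (𝒦.ideal d).support.compl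
      (preimage_support_compl_of_comap_eq M (fun g => hprin.2.1 g d)) hsupp
    exact ⟨b, hb, hub, Set.disjoint_left.mpr fun x hx hx' => (hle hx) hx'⟩
  -- the atlas
  let 𝔄' : NodeAtlasData p M'.act g₀ :=
    { ι := J ⊕ W
      O := Sum.elim OJ OW
      D := fun x => match x with
        | Sum.inl j => DJ j
        | Sum.inr w => DW w
      cover := fun v' => by
        by_cases hv : π'.base v' ∈ ⋃ c, ((Oc c).1 : Set M.V)
        · obtain ⟨c, hc⟩ := Set.mem_iUnion.mp hv
          exact ⟨Sum.inr ⟨c, v', hc⟩, (hW ⟨c, v', hc⟩).1⟩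
        · obtain ⟨i, hi⟩ := 𝔄.cover (π'.base v')
          obtain ⟨b, hb, hub, hdisj⟩ := hoffb _ hv i hi
          exact ⟨Sum.inl ⟨i, b, hb, hdisj⟩, hub⟩ }
  refine ⟨𝔄', fun v' => ⟨fun hv' => ?_, fun h => ?_⟩⟩
  · -- (B-over) and (B-off →)
    have hU : π'.base v' ∉ ⋃ c, ((Oc c).1 : Set M.V) := fun h => by
      obtain ⟨c, hc⟩ := Set.mem_iUnion.mp h
      exact (NodeAtlasData.mem_fLocus_iff v').mp hv' (Sum.inr ⟨c, v', hc⟩) (hW ⟨c, v', hc⟩).1 (hW ⟨c, v', hc⟩).2.2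
    refine ⟨hU, ?_⟩
    by_contra hF
    obtain ⟨i, hPi⟩ := (NodeAtlasData.not_mem_fLocus_iff (π'.base v')).mp hF
    obtain ⟨b, hb, hub, hdisj⟩ := hoffb _ hU i ((𝔄.D i).mem_of_principalNear hPi)
    exact (NodeAtlasData.mem_fLocus_iff v').mp hv' (Sum.inl ⟨i, b, hb, hdisj⟩) hub ((hJ ⟨i, b, hb, hdisj⟩ v').mpr ⟨hub, hPi⟩)
  · -- (B-off ←)
    obtain ⟨hU, hF⟩ := h
    rw [NodeAtlasData.mem_fLocus_iff]
    rintro (j | w) hmem hpn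
    · obtain ⟨hub, h⟩ := (hJ j v').mp hpn
      exact (NodeAtlasData.mem_fLocus_iff _).mp hF j.1 (M.V.basicOpen_le j.2.1 hub) h
    · exact hU (Set.mem_iUnion.mpr ⟨w.1, (hW w).2.1 hmem⟩)

end Atlas

/-! ## ★★★ The (KN) node is kernel -/

/-- ★★★ **THE (KN) NODE IS KERNEL.** At a decorated model `(M, 𝔄)` of finite type over a Noetherian base (`HasNoetherianBase`), compact with `dim F_𝔄 < n`:
a NAMED principal centre `(𝒦, d)` with a DESIGNATED family of principal-centre charts covering its support, whose support meets a TOP-dimensional component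
`t` of `F_𝔄`, is a depth-1 `TreeF` node reaching `μ_F`-LOWER decorated models — provided the class `P` accepts, on every realisation `M′`, every decoration
whose formal locus is EXACTLY `π′⁻¹(F_𝔄 ∖ ⋃ O_c)` (witnessed by `exists_killAtlas`). No compatibility, no ADD-NP, no K.
[OURS · L1 W4.5c · A-KF v0 (KN); plan-1 ASSIGNMENT v10.34 `treeF_one_of_namedKill`] -/
theorem treeF_one_of_namedKill {P : ∀ N : GModel p q G ρ g₀, NodeAtlasData p N.act g₀ → Prop} [Finite G] (hp : p.Prime)
    (hG : ∀ g : G, g ∈ Subgroup.zpowers g₀) (M : GModel p q G ρ g₀) [CompactSpace M.V] (hB : M.HasNoetherianBase) (𝔄 : NodeAtlasData p M.act g₀)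
    {n : ℕ} (hdim : M.fdim 𝔄 < n) (𝒦 : ReesFiltration M.V) (d : ℕ) (hprin : IsPrincipalCentre p M.act g₀ 𝒦 d)
    {κ : Type} (Oc : κ → M.act.StableAffineOpens) (hOc : ∀ c, IsPrincipalCentreChart p M.act g₀ 𝒦 d (Oc c))
    (hcov : ((𝒦.ideal d).support : Set M.V) ⊆ ⋃ c, ((Oc c).1 : Set M.V))
    {t : Set ↥𝔄.fLocus} (ht : t ∈ irreducibleComponents ↥𝔄.fLocus) (hdt : topologicalKrullDim ↥t = M.fdim 𝔄)
    (htouch : ∃ x ∈ t, (x : M.V) ∈ ((𝒦.ideal d).support : Set M.V))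
    (hP : ∀ (M' : GModel p q G ρ g₀) (π' : M'.V ⟶ M.V), IsBlowup π' (𝒦.ideal d) → M'.π = π' ≫ M.π → M'.r = π' ≫ M.r →
      (∀ g : G, (M'.act.aut g).hom ≫ π' = π' ≫ (M.act.aut g).hom) →
      ∀ 𝔄' : NodeAtlasData p M'.act g₀,
        (∀ v' : M'.V, v' ∈ 𝔄'.fLocus ↔ π'.base v' ∉ (⋃ c, ((Oc c).1 : Set M.V)) ∧ π'.base v' ∈ 𝔄.fLocus) → P M' 𝔄') :
    TreeF P (fun N 𝔅 => LexLTF N 𝔅 M 𝔄) 1 M 𝔄 := by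
  obtain ⟨R₀, _, _, s, _, hs⟩ := hB
  refine Or.inr (Or.inr ⟨𝒦, d, isAdmissibleCentre_of_isPrincipalCentre hprin, fun M' hm => ?_⟩)
  obtain ⟨π', hbl, hπ, hr, hcomm⟩ := hm
  have hUo : IsOpen (⋃ c, ((Oc c).1 : Set M.V)) := isOpen_iUnion fun c => (Oc c).1.isOpen
  obtain ⟨𝔄', h𝔄'⟩ := exists_killAtlas hp hG M M' 𝔄 𝒦 d hprin Oc hOc hcov π' hbl hr hcomm s hs
  exact ⟨𝔄', hP M' π' hbl hπ hr hcomm 𝔄' h𝔄',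
    lexLTF_of_principalMove_of_bookkeeping' M M' 𝔄 hdim 𝒦 d hUo hcov ht hdt htouch π' hbl 𝔄' fun v' hv' => (h𝔄' v').mp hv'⟩

/-- ★★ **COROLLARY (designated family = ALL principal-centre charts, `U = principalKillOpen`).** -/
theorem treeF_one_of_namedKill' {P : ∀ N : GModel p q G ρ g₀, NodeAtlasData p N.act g₀ → Prop} [Finite G] (hp : p.Prime)
    (hG : ∀ g : G, g ∈ Subgroup.zpowers g₀) (M : GModel p q G ρ g₀) [CompactSpace M.V] (hB : M.HasNoetherianBase) (𝔄 : NodeAtlasData p M.act g₀)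
    {n : ℕ} (hdim : M.fdim 𝔄 < n) (𝒦 : ReesFiltration M.V) (d : ℕ) (hprin : IsPrincipalCentre p M.act g₀ 𝒦 d)
    {t : Set ↥𝔄.fLocus} (ht : t ∈ irreducibleComponents ↥𝔄.fLocus) (hdt : topologicalKrullDim ↥t = M.fdim 𝔄)
    (htouch : ∃ x ∈ t, (x : M.V) ∈ ((𝒦.ideal d).support : Set M.V))
    (hP : ∀ (M' : GModel p q G ρ g₀) (π' : M'.V ⟶ M.V), IsBlowup π' (𝒦.ideal d) → M'.π = π' ≫ M.π → M'.r = π' ≫ M.r →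
      (∀ g : G, (M'.act.aut g).hom ≫ π' = π' ≫ (M.act.aut g).hom) →
      ∀ 𝔄' : NodeAtlasData p M'.act g₀,
        (∀ v' : M'.V, v' ∈ 𝔄'.fLocus ↔ π'.base v' ∉ M.principalKillOpen 𝒦 d ∧ π'.base v' ∈ 𝔄.fLocus) → P M' 𝔄') :
    TreeF P (fun N 𝔅 => LexLTF N 𝔅 M 𝔄) 1 M 𝔄 := by
  let κ : Type := {O : M.act.StableAffineOpens // IsPrincipalCentreChart p M.act g₀ 𝒦 d O}
  have hU : (⋃ c : κ, ((c.1).1 : Set M.V)) = M.principalKillOpen 𝒦 d := by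
    ext x
    simp only [principalKillOpen, Set.mem_iUnion]
    exact ⟨fun ⟨c, hc⟩ => ⟨c.1, c.2, hc⟩, fun ⟨O, hO, hx⟩ => ⟨⟨O, hO⟩, hx⟩⟩
  refine treeF_one_of_namedKill hp hG M hB 𝔄 hdim 𝒦 d hprin (fun c : κ => c.1) (fun c => c.2) ?_ ht hdt htouch fun M' π' hbl hπ hr hcomm 𝔄' h𝔄' =>
    hP M' π' hbl hπ hr hcomm 𝔄' fun v' => by rw [h𝔄', hU]
  rw [hU]
  exact M.support_subset_principalKillOpen hprin

end Summit.ResolutionOfSingularities.ResolutionOfSingularities.Theorems.WildQuotientResolution.S1.GameFrame.GModel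

end
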